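import Literature.Geometry.Kaehler.StrataClassVanishing
import Literature.NumberTheory.Transcendental.AnalytificationExistenceProofs
import Literature.NumberTheory.Transcendental.AnalytificationFunctorialityProofs
import Literature.NumberTheory.Transcendental.AnalytificationCompactProofs
import Literature.AlgebraicGeometry.Motives.GAGAKaehlerImmersionProofs
import Literature.AlgebraicGeometry.HodgeTheory.GysinFormalism
import Literature.AlgebraicGeometry.HodgeTheory.LefschetzOneOneChowClosed
import Literature.AlgebraicGeometry.HodgeTheory.HypersurfaceComplexPoints
import HarnessLib

/-!
# Classes dying on the smooth strata of a family of closed subschemes die near their union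

Topic `Literature/AlgebraicGeometry/HodgeTheory`. The algebraic-to-analytic step of the direct
route to P. Deligne, *Théorie de Hodge III* (1974), Prop. 8.2.7 / Cor. 8.2.8: let `X` be a
smooth proper `ℂ`-scheme of relative dimension `n` with a closed immersion into a projective
space, and `D i` (`i : ι`, finite) ideal sheaves on `X` such that every "stratum"
`E_I = V(⨆_{i ∈ I} D i)` (`I : Finset ι`) is smooth over `ℂ` of some relative dimension `d I` —
e.g. the components of a simple normal crossing divisor. Then a class `u ∈ H^q(X(ℂ); ℂ)` whose
pull-back to every `E_{i}(ℂ)` vanishes vanishes on an open neighbourhood of `⋃ i, V(D i)(ℂ)`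
(`exists_isOpen_map_subsetIncl_eq_zero_of_strata`).

Proof: analytify everything (`exists_isAnalytification_holds`, Serre's GAGA §2: the strata and
`X` become compact Kähler manifolds, `isKaehlerManifold_of_isAnalytification_of_isClosedImmersion_holds`,
the inclusions holomorphic maps, `mdifferentiable_comp_map_holds`), obtaining an embedded strata
system (`Geometry.Kaehler.StrataMaps`) whose higher strata are the intersections of the
codimension-one ones (`Scheme.IdealSheafData.support_iSup`), and apply the compact-Kähler theorem
`StrataMaps.exists_isOpen_map_subtypeVal_eq_zero_complex` (`StrataClassVanishing`); finally
transport back along the homeomorphism `X^an ≃ X(ℂ)`. Everything is proved; no named facts (D-0026).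

## References

* [DeligneHodgeIII1974] P. Deligne, *Théorie de Hodge III*, Publ. Math. IHÉS 44 (1974), Prop. 8.2.7.
* [SerreGAGA1956] J.-P. Serre, *Géométrie algébrique et géométrie analytique*, Ann. Inst. Fourier 6
  (1956), §2.
* [VoisinHodgeI2002] C. Voisin, *Hodge Theory and Complex Algebraic Geometry I* (2002), §3.3.2.
-/

noncomputable section

-- `Over.left X` / `X.left` and the `TangentSpace` abbreviations are unfolded by `isDefEq`, as in the
-- files this one builds on (see "Implementation notes" in `…SingularHomology.SingularChainsConcrete`)
set_option backward.isDefEq.respectTransparency false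

open CategoryTheory AlgebraicGeometry
open scoped Manifold ContDiff Topology
open Literature.AlgebraicTopology.SingularHomology Literature.NumberTheory.Transcendental
open Literature.Geometry.Kaehler

namespace Literature.AlgebraicGeometry.HodgeTheory

open Literature.AlgebraicGeometry.Motives

/-! ### §1 The strata of a family of ideal sheaves -/

section Strata

variable {X : SchemeOver ℂ} {ι : Type} (D : ι → X.left.IdealSheafData)

/-- The ideal `⨆_{i ∈ I} D i` of the stratum indexed by the finite set `I`. [folklore] -/
def strataIdeal (I : Finset ι) : X.left.IdealSheafData :=
  ⨆ i ∈ I, D i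

/-- The strata ideals grow with the index set. [folklore] -/
theorem strataIdeal_mono {I J : Finset ι} (h : I ⊆ J) : strataIdeal D I ≤ strataIdeal D J :=
  iSup₂_le fun i hi ↦ le_iSup₂ (f := fun i (_ : i ∈ J) ↦ D i) i (h hi)

/-- The ideal of the stratum `{i}` is `D i`. [folklore] -/
theorem strataIdeal_singleton (i : ι) : strataIdeal D {i} = D i := by
  simp [strataIdeal]

/-- The support of a stratum is the intersection of the supports. [folklore] -/
theorem coe_support_strataIdeal (I : Finset ι) :
    ((strataIdeal D I).support : Set X.left) = ⋂ i ∈ I, ((D i).support : Set X.left) := by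
  simp only [strataIdeal, Scheme.IdealSheafData.support_iSup, TopologicalSpace.Closeds.coe_iInf]

/-- **The stratum `E_I = V(⨆_{i∈I} D i)`** as a `ℂ`-scheme. [folklore] -/
def strataScheme (I : Finset ι) : SchemeOver ℂ :=
  Over.mk ((strataIdeal D I).subschemeι ≫ X.hom)

/-- The closed immersion `E_I ↪ X`. [folklore] -/
def strataHom (I : Finset ι) : strataScheme D I ⟶ X :=
  Over.homMk (strataIdeal D I).subschemeι rfl

/-- The inclusion `E_J ↪ E_I` for `I ⊆ J`. [folklore] -/
def strataRes {I J : Finset ι} (h : I ⊆ J) : strataScheme D J ⟶ strataScheme D I :=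
  Over.homMk (Scheme.IdealSheafData.inclusion (strataIdeal_mono D h)) (by
    change _ ≫ (strataIdeal D I).subschemeι ≫ X.hom = (strataIdeal D J).subschemeι ≫ X.hom
    rw [← Category.assoc, Scheme.IdealSheafData.inclusion_subschemeι])

/-- The underlying morphism of `strataHom`. [folklore] -/
@[simp] theorem strataHom_left (I : Finset ι) : (strataHom D I).left = (strataIdeal D I).subschemeι := rfl

/-- The underlying morphism of `strataRes`. [folklore] -/
@[simp] theorem strataRes_left {I J : Finset ι} (h : I ⊆ J) :
    (strataRes D h).left = Scheme.IdealSheafData.inclusion (strataIdeal_mono D h) := rfl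

/-- The structure morphism of a stratum. [folklore] -/
@[simp] theorem strataScheme_hom (I : Finset ι) :
    (strataScheme D I).hom = (strataIdeal D I).subschemeι ≫ X.hom := rfl

/-- `E_J ↪ E_I ↪ X` is `E_J ↪ X`. [folklore] -/
theorem strataRes_comp_strataHom {I J : Finset ι} (h : I ⊆ J) :
    strataRes D h ≫ strataHom D I = strataHom D J := by
  ext : 1
  simp

/-- `E_I ↪ E_I` is the identity. [folklore] -/
theorem strataRes_self (I : Finset ι) (h : I ⊆ I) : strataRes D h = 𝟙 _ := by
  ext : 1
  exact Scheme.IdealSheafData.inclusion_id _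

/-- The inclusions compose. [folklore] -/
theorem strataRes_comp {I J K : Finset ι} (hIJ : I ⊆ J) (hJK : J ⊆ K) :
    strataRes D hJK ≫ strataRes D hIJ = strataRes D (hIJ.trans hJK) := by
  ext : 1
  simp

/-- `E_I ↪ X` is a closed immersion. [folklore] -/
instance isClosedImmersion_strataHom_left (I : Finset ι) : IsClosedImmersion (strataHom D I).left := by
  rw [strataHom_left]; infer_instance

/-- The strata are locally of finite type. [folklore] -/
instance locallyOfFiniteType_strataScheme_hom [LocallyOfFiniteType X.hom] (I : Finset ι) :
    LocallyOfFiniteType (strataScheme D I).hom := by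
  rw [strataScheme_hom]; infer_instance

/-- The strata are separated. [folklore] -/
instance isSeparated_strataScheme_hom [IsSeparated X.hom] (I : Finset ι) :
    IsSeparated (strataScheme D I).hom := by
  rw [strataScheme_hom]; infer_instance

/-- The strata are proper. [folklore] -/
instance isProper_strataScheme_hom [IsProper X.hom] (I : Finset ι) : IsProper (strataScheme D I).hom := by
  rw [strataScheme_hom]; infer_instance

/-- A stratum followed by a closed immersion is a closed immersion. [folklore] -/
instance isClosedImmersion_strataHom_comp_left {Y : SchemeOver ℂ} (g : X ⟶ Y) [IsClosedImmersion g.left]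
    (I : Finset ι) : IsClosedImmersion (strataHom D I ≫ g).left := by
  rw [Over.comp_left, strataHom_left]; infer_instance

/-- The complex points of a stratum, seen in `X(ℂ)`, are the points lying on the support. [folklore] -/
theorem range_map_strataHom (I : Finset ι) :
    Set.range (AlgPoints.map (L := ℂ) (strataHom D I)) =
      {P : ComplexPoints X | P.pt ∈ ((strataIdeal D I).support : Set X.left)} := by
  rw [range_map_eq_setOf_pt_mem_range]
  have h : Set.range ((strataIdeal D I).subschemeι : (strataIdeal D I).subscheme ⟶ X.left) =
      ((strataIdeal D I).support : Set X.left) := Scheme.IdealSheafData.range_subschemeι _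
  exact congrArg (fun S : Set X.left ↦ {P : ComplexPoints X | P.pt ∈ S}) h

end Strata

/-! ### §2 The statement -/

section Main

/-- Pull-back along a homeomorphism is injective on singular cohomology. [folklore] -/
theorem singularCohomology_map_eq_zero_of_comp_homeomorph {A B Y : Type} [TopologicalSpace A]
    [TopologicalSpace B] [TopologicalSpace Y] (e : A ≃ₜ B) (g : C(B, Y)) {q : ℕ}
    (u : singularCohomology ℂ ℂ Y q)
    (h : singularCohomology.map ℂ ℂ (g.comp (e : C(A, B))) q u = 0) :
    singularCohomology.map ℂ ℂ g q u = 0 := by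
  rw [singularCohomology.map_comp, ModuleCat.comp_apply] at h
  have hinj : Function.Injective (singularCohomology.map ℂ ℂ (e : C(A, B)) q) :=
    ((forget (ModuleCat ℂ)).mapIso (singularCohomology.mapIso ℂ ℂ e q)).toEquiv.injective
  exact hinj (h.trans (map_zero _).symm)

/-- **Classes dying on the smooth strata of a family of closed subschemes die near their union**
(Deligne, Hodge III, Prop. 8.2.7 / Cor. 8.2.8, for the components of a normal crossing
configuration in a smooth projective variety): if every stratum `E_I = V(⨆_{i∈I} D i)` of the
smooth proper `X ↪ ℙᴺ_ℂ` is smooth over `ℂ`, then a class `u ∈ H^q(X(ℂ); ℂ)` with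
`(E_{i} ↪ X)(ℂ)^* u = 0` for all `i` vanishes on an open neighbourhood of `⋃ i, V(D i)(ℂ)`.
Proof: GAGA (analytifications are compact Kähler manifolds, inclusions holomorphic) and the
compact-Kähler theorem `StrataMaps.exists_isOpen_map_subtypeVal_eq_zero_complex`.
[cite: DeligneHodgeIII1974, Prop. 8.2.7] [cite: SerreGAGA1956, §2] -/
theorem exists_isOpen_map_subsetIncl_eq_zero_of_strata {n N : ℕ} {X : SchemeOver ℂ}
    [SmoothOfRelativeDimension n X.hom] [IsProper X.hom]
    (ιX : X ⟶ projectiveSpace N ℂ) [IsClosedImmersion ιX.left]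
    {ι : Type} [LinearOrder ι] [Fintype ι] (D : ι → X.left.IdealSheafData)
    (d : Finset ι → ℕ) [hsm : ∀ I, SmoothOfRelativeDimension (d I) (strataScheme D I).hom]
    {q : ℕ} (u : complexBetti X q) (hu : ∀ i, complexBetti.map (strataHom D {i}) q u = 0) :
    ∃ V : Set (ComplexPoints X), IsOpen V ∧
      {P | P.pt ∈ ⋃ i, ((D i).support : Set X.left)} ⊆ V ∧
      singularCohomology.map ℂ ℂ (subsetIncl V) q u = 0 := by
  classical
  -- analytifications
  obtain ⟨MX, tX, t2X, csX, mfX, φX, hφX⟩ := exists_isAnalytification_holds X n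
  have hA : ∀ I : Finset ι, ∃ (M : Type) (_ : TopologicalSpace M) (_ : T2Space M)
      (_ : ChartedSpace (Fin (d I) → ℂ) M) (_ : IsManifold 𝓘(ℂ, Fin (d I) → ℂ) ω M)
      (φ : M → ComplexPoints (strataScheme D I)), IsAnalytification (Fin (d I) → ℂ) (strataScheme D I) (d I) φ :=
    fun I ↦ exists_isAnalytification_holds (strataScheme D I) (d I)
  choose MP tP t2P csP mfP φP hφP using hA
  -- instances
  letI : ∀ I, TopologicalSpace (MP I) := tP
  letI : ∀ I, ChartedSpace (Fin (d I) → ℂ) (MP I) := csP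
  haveI : ∀ I, T2Space (MP I) := t2P
  haveI : ∀ I, IsManifold 𝓘(ℂ, Fin (d I) → ℂ) ω (MP I) := mfP
  haveI : ∀ I, IsManifold 𝓘(ℝ, Fin (d I) → ℂ) ∞ (MP I) := fun I ↦ isManifold_real_of_isManifold_complex
  haveI : IsManifold 𝓘(ℝ, Fin n → ℂ) ∞ MX := isManifold_real_of_isManifold_complex
  haveI : ∀ I, CompactSpace (MP I) := fun I ↦ (hφP I).compactSpace_of_isProper
  haveI : CompactSpace MX := hφX.compactSpace_of_isProper
  haveI : ∀ I, SecondCountableTopology (MP I) := fun I ↦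
    ChartedSpace.secondCountable_of_sigmaCompact (Fin (d I) → ℂ) (MP I)
  haveI : SecondCountableTopology MX := ChartedSpace.secondCountable_of_sigmaCompact (Fin n → ℂ) MX
  haveI : ∀ I, IsKaehlerManifold (Fin (d I) → ℂ) (MP I) := fun I ↦
    isKaehlerManifold_of_isAnalytification_of_isClosedImmersion_holds (strataHom D I ≫ ιX) (hφP I)
  haveI : IsKaehlerManifold (Fin n → ℂ) MX :=
    isKaehlerManifold_of_isAnalytification_of_isClosedImmersion_holds ιX hφX
  -- the homeomorphisms
  set ΦX : MX ≃ₜ ComplexPoints X := hφX.homeomorph with hΦX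
  have hΦXc : (ΦX : MX → ComplexPoints X) = φX := hφX.coe_homeomorph
  set ΦP : ∀ I, MP I ≃ₜ ComplexPoints (strataScheme D I) := fun I ↦ (hφP I).homeomorph with hΦP
  have hΦPc : ∀ I, (ΦP I : MP I → ComplexPoints (strataScheme D I)) = φP I := fun I ↦ (hφP I).coe_homeomorph
  -- the strata system
  let emb : ∀ I : Finset ι, MP I → MX := fun I ↦ ΦX.symm ∘ AlgPoints.map (strataHom D I) ∘ φP I
  let res : ∀ ⦃I J : Finset ι⦄, I ⊆ J → MP J → MP I := fun I J h ↦
    (ΦP I).symm ∘ AlgPoints.map (strataRes D h) ∘ φP J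
  have hemb_hol : ∀ I, MDifferentiable 𝓘(ℂ, Fin (d I) → ℂ) 𝓘(ℂ, Fin n → ℂ) (emb I) := fun I ↦
    IsAnalytification.mdifferentiable_comp_map_holds (hφP I) hφX (strataHom D I) (emb I) (by
      funext y
      change φX (ΦX.symm _) = _
      rw [← hΦXc, ΦX.apply_symm_apply])
  have hres_hol : ∀ ⦃I J⦄ (h : I ⊆ J), MDifferentiable 𝓘(ℂ, Fin (d J) → ℂ) 𝓘(ℂ, Fin (d I) → ℂ) (res h) :=
    fun I J h ↦ IsAnalytification.mdifferentiable_comp_map_holds (hφP J) (hφP I) (strataRes D h) (res h) (by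
      funext y
      change φP I ((ΦP I).symm _) = _
      rw [← hΦPc, (ΦP I).apply_symm_apply])
  let T : StrataMaps (EM := Fin n → ℂ) MX (fun I ↦ Fin (d I) → ℂ) MP :=
    { emb := emb
      res := res
      emb_comp_res := fun I J h ↦ by
        funext y
        change ΦX.symm (AlgPoints.map (strataHom D I)
          (φP I ((ΦP I).symm (AlgPoints.map (strataRes D h) (φP J y))))) =
          ΦX.symm (AlgPoints.map (strataHom D J) (φP J y))
        rw [← hΦPc I, (ΦP I).apply_symm_apply, ← AlgPoints.map_comp_apply, strataRes_comp_strataHom]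
      res_self := fun I h ↦ by
        funext y
        change (ΦP I).symm (AlgPoints.map (strataRes D h) (φP I y)) = y
        rw [strataRes_self, AlgPoints.map_id_apply, ← hΦPc, (ΦP I).symm_apply_apply]
      res_comp_res := fun I J K hIJ hJK ↦ by
        funext y
        change (ΦP I).symm (AlgPoints.map (strataRes D hIJ)
          (φP J ((ΦP J).symm (AlgPoints.map (strataRes D hJK) (φP K y))))) =
          (ΦP I).symm (AlgPoints.map (strataRes D (hIJ.trans hJK)) (φP K y))
        rw [← hΦPc J, (ΦP J).apply_symm_apply, ← AlgPoints.map_comp_apply, strataRes_comp]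
      mdifferentiable_emb := hemb_hol
      contMDiff_emb := fun I ↦ (hemb_hol I).contMDiff_real_of_complex
      mdifferentiable_res := hres_hol
      contMDiff_res := fun I J h ↦ (hres_hol h).contMDiff_real_of_complex }
  -- injectivity and the ranges of the strata
  have hinj : ∀ I, Function.Injective (T.emb I) := fun I ↦
    ΦX.symm.injective.comp ((AlgPoints.isEmbedding_map_of_isClosedImmersion (L := ℂ)
      (strataHom D I)).injective.comp (hφP I).isHomeomorph.injective)
  have hrangeI : ∀ I, Set.range (T.emb I) =
      ΦX.symm '' {P : ComplexPoints X | P.pt ∈ ((strataIdeal D I).support : Set X.left)} := by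
    intro I
    change Set.range (ΦX.symm ∘ AlgPoints.map (strataHom D I) ∘ φP I) = _
    rw [Set.range_comp, Set.range_comp, (hφP I).isHomeomorph.surjective.range_eq, Set.image_univ,
      range_map_strataHom]
  have hrange : ∀ I : Finset ι, I.Nonempty → Set.range (T.emb I) = ⋂ i ∈ I, Set.range (T.emb {i}) := by
    intro I _
    rw [hrangeI, ← ΦX.symm.preimage_symm, coe_support_strataIdeal, Set.preimage_setOf_eq]
    ext y
    simp only [Set.mem_iInter, Set.mem_setOf_eq, hrangeI, ← ΦX.symm.preimage_symm, Set.preimage_setOf_eq,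
      strataIdeal_singleton]
  -- the transported class
  set u' : singularCohomology ℂ ℂ MX q := singularCohomology.map ℂ ℂ (ΦX : C(MX, ComplexPoints X)) q u
    with hu'
  have hu'i : ∀ i, singularCohomology.map ℂ ℂ ⟨T.emb {i}, (T.contMDiff_emb {i}).continuous⟩ q u' = 0 := by
    intro i
    have e : (ΦX : C(MX, ComplexPoints X)).comp ⟨T.emb {i}, (T.contMDiff_emb {i}).continuous⟩ =
        (AlgPoints.mapContinuous (L := ℂ) (strataHom D {i})).comp
          (ΦP {i} : C(MP {i}, ComplexPoints (strataScheme D {i}))) := by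
      refine ContinuousMap.ext fun y ↦ ?_
      change ΦX (ΦX.symm (AlgPoints.map (strataHom D {i}) (φP {i} y))) =
        AlgPoints.map (strataHom D {i}) (ΦP {i} y)
      rw [ΦX.apply_symm_apply, hΦPc]
    rw [hu', ← ModuleCat.comp_apply, ← singularCohomology.map_comp, e, singularCohomology.map_comp,
      ModuleCat.comp_apply]
    change singularCohomology.map ℂ ℂ _ q (complexBetti.map (strataHom D {i}) q u) = 0
    rw [hu i, map_zero]
  obtain ⟨V, hVo, hKV, hV0⟩ := T.exists_isOpen_map_subtypeVal_eq_zero_complex hinj hrange u' hu'i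
  -- transport back to `X(ℂ)`
  refine ⟨ΦX '' V, ΦX.isOpenMap V hVo, ?_, ?_⟩
  · rintro P ⟨_, ⟨i, rfl⟩, hP⟩
    have hmem : ΦX.symm P ∈ Set.range (T.emb {i}) := by
      rw [hrangeI, strataIdeal_singleton]
      exact ⟨P, hP, rfl⟩
    exact ⟨ΦX.symm P, hKV i hmem, ΦX.apply_symm_apply P⟩
  · -- the square `↥V ≃ ↥(ΦX '' V)` over `ΦX`
    let e : ↥V ≃ₜ ↥(ΦX '' V) := ΦX.image V
    refine singularCohomology_map_eq_zero_of_comp_homeomorph e (subsetIncl (ΦX '' V)) u ?_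
    have hsq : (subsetIncl (ΦX '' V)).comp (e : C(↥V, ↥(ΦX '' V))) =
        (ΦX : C(MX, ComplexPoints X)).comp ⟨Subtype.val, continuous_subtype_val⟩ := by
      exact ContinuousMap.ext fun y ↦ rfl
    rw [hsq, singularCohomology.map_comp, ModuleCat.comp_apply, ← hu', hV0]

end Main

end Literature.AlgebraicGeometry.HodgeTheory
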